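import Summits.KontsevichZagierPeriods.KontsevichZagierPeriods.Theorems.LinRedNormalFormArrangementNormalFormSeparateAllHHNest
import Summits.KontsevichZagierPeriods.KontsevichZagierPeriods.Theorems.LinRedNormalFormArrangementNormalFormSeparateAllHHMonoSplit

/-!
# Nested thin sectors of any depth: the blow-up chart

(Line `janus-bands`, crux `ArrangementNormalForm`, stub `stub_separateHigh_hH`, part `AllHHChart` of
the dimension-generic wall-invariant termwise-split lemma, base dimension `b + 1 ≥ 4` with fibres;
namespace `SepAll`.)
The measure-theoretic chart of the local analysis of the Taylor pieces at a base point `z₁ ∈ ℝ^D`.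
For a frame `f : Fin D → ℝ^D` (frame matrix `fmat f` with columns `f l`, `(fmat f).det ≠ 0`) the
NESTED THIN SECTOR `nsec z₁ f δ = {z₁ + ∑_l cum w l • f l | w ∈ box δ}` is the image of the open box
under the polynomial chart `w ↦ z₁ + npt f w`, the composition of the frame matrix with the nested
product map `w ↦ (cum w l)_l` (part `AllHHNest`). Its derivative is `fmat f · cjac w` with the LOWER
TRIANGULAR matrix `cjac w` of partial derivatives of the nested products, of determinant
`jac w = ∏_l ∏_{k<l} w_k` (`det_cjac`); the chart is injective on the open box (`npt_injOn`), so by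
the change of variables formula
`∫⁻_{nsec z₁ f δ} G = |det (fmat f)| · ∫⁻_{box δ} jac w · G (z₁ + npt f w)` (`lintegral_nsec`,
registered as `separateAllHH_chart`). Also: the `Fin.cons` recursion of `npt`, continuity,
monotonicity of `jac`.
-/

noncomputable section

open Set Finset MeasureTheory
open scoped ENNReal

namespace Summit.KontsevichZagierPeriods.ArrangementNormalForm.JanusBands

namespace SepAll

variable {D E : ℕ}

/-! ### The nested point and the frame matrix -/

/-- The point of the nested sector (based at the origin) with blown-up coordinates `w`, for `D`
levels in the ambient space `ℝ^E`. -/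
def npt (f : Fin D → Fin E → ℝ) (w : Fin D → ℝ) : Fin E → ℝ := ∑ l, cum w l • f l

/-- The nested thin sector at `z₁` with frame `f` at scale `δ`. -/
def nsec (z₁ : Fin D → ℝ) (f : Fin D → Fin D → ℝ) (δ : Fin D → ℝ) : Set (Fin D → ℝ) :=
  (fun w => z₁ + npt f w) '' box δ

/-- The frame matrix: its columns are the frame vectors. -/
def fmat (f : Fin D → Fin D → ℝ) : Matrix (Fin D) (Fin D) ℝ := Matrix.of fun i l => f l i

/-- Coordinates of the nested point. -/
theorem npt_apply (f : Fin D → Fin E → ℝ) (w : Fin D → ℝ) (i : Fin E) :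
    npt f w i = ∑ l, cum w l * f l i := by
  simp [npt, Finset.sum_apply, smul_eq_mul]

/-- The nested point is the frame matrix applied to the nested products. -/
theorem npt_eq_mulVec (f : Fin D → Fin D → ℝ) (w : Fin D → ℝ) :
    npt f w = (fmat f).mulVec (fun l => cum w l) := by
  funext i
  rw [npt_apply, Matrix.mulVec, dotProduct]
  simp [fmat, mul_comm]

/-- The `Fin.cons` recursion of the nested point: `npt (d, f') (t, w') = t • (d + npt f' w')`. -/
theorem npt_cons (d : Fin E → ℝ) (f : Fin D → Fin E → ℝ) (t : ℝ) (w : Fin D → ℝ) :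
    npt (Fin.cons d f : Fin (D + 1) → Fin E → ℝ) (Fin.cons t w) = t • (d + npt f w) := by
  unfold npt
  rw [Fin.sum_univ_succ, cum_cons_zero]
  simp only [Fin.cons_zero, Fin.cons_succ, cum_cons_succ]
  rw [smul_add, Finset.smul_sum]
  congr 1
  refine Finset.sum_congr rfl fun l _ => ?_
  rw [smul_smul]

/-- The nested point at the corner. -/
theorem npt_zero (f : Fin D → Fin E → ℝ) : npt f 0 = 0 := by
  unfold npt
  refine Finset.sum_eq_zero fun l _ => ?_
  by_cases hD : D = 0
  · subst hD; exact l.elim0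
  · have : cum (0 : Fin D → ℝ) l = 0 := by
      unfold cum
      exact Finset.prod_eq_zero (Finset.mem_univ l) (by simp)
    rw [this, zero_smul]

/-- Nested products are continuous. -/
theorem continuous_cum (l : Fin D) : Continuous fun w : Fin D → ℝ => cum w l := by
  unfold cum
  exact continuous_finsetProd _ fun j _ => by
    split_ifs <;> [exact continuous_apply j; exact continuous_const]

/-- The nested point map is continuous. -/
theorem continuous_npt (f : Fin D → Fin E → ℝ) : Continuous (npt f) := by
  unfold npt
  exact continuous_finsetSum _ fun l _ => (continuous_cum l).smul continuous_const

/-- Linear images of nested points: applying a linear map to the frame. -/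
theorem map_npt {E' : ℕ} (L : (Fin E → ℝ) →ₗ[ℝ] (Fin E' → ℝ)) (f : Fin D → Fin E → ℝ) (w : Fin D → ℝ) :
    L (npt f w) = npt (fun l => L (f l)) w := by
  simp [npt, map_sum, map_smul]

/-! ### The Jacobian -/

/-- The matrix of partial derivatives of the nested products: row `l`, column `j`. -/
def cjac (w : Fin D → ℝ) : Matrix (Fin D) (Fin D) ℝ :=
  Matrix.of fun l j => if j ≤ l then ∏ k ∈ univ.erase j, (if k ≤ l then w k else 1) else 0

/-- The Jacobian determinant of the nested product map: `∏_l ∏_{k<l} w_k`. -/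
def jac (w : Fin D → ℝ) : ℝ := ∏ l, ∏ k ∈ univ.erase l, (if k ≤ l then w k else 1)

/-- The matrix of partial derivatives is lower triangular. -/
theorem cjac_blockTriangular (w : Fin D → ℝ) : (cjac w).BlockTriangular OrderDual.toDual := by
  intro l j hlt
  have h : l < j := hlt
  simp [cjac, not_le.2 h]

/-- **The Jacobian determinant.** -/
theorem det_cjac (w : Fin D → ℝ) : (cjac w).det = jac w := by
  rw [Matrix.det_of_lowerTriangular _ (cjac_blockTriangular w), jac]
  refine Finset.prod_congr rfl fun l _ => ?_
  simp [cjac]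

/-- The Jacobian is positive on the open positive orthant. -/
theorem jac_pos {w : Fin D → ℝ} (hw : ∀ j, 0 < w j) : 0 < jac w :=
  prod_pos fun l _ => prod_pos fun k _ => by split_ifs <;> [exact hw k; exact one_pos]

/-- The Jacobian is non-negative on the closed positive orthant. -/
theorem jac_nonneg {w : Fin D → ℝ} (hw : ∀ j, 0 ≤ w j) : 0 ≤ jac w :=
  prod_nonneg fun l _ => prod_nonneg fun k _ => by split_ifs <;> [exact hw k; exact zero_le_one]

/-- The Jacobian is monotone in every coordinate on the positive orthant. -/
theorem jac_mono {w w' : Fin D → ℝ} (hw : ∀ j, 0 ≤ w j) (h : ∀ j, w j ≤ w' j) : jac w ≤ jac w' :=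
  prod_le_prod (fun l _ => prod_nonneg fun k _ => by split_ifs <;> [exact hw k; exact zero_le_one])
    fun l _ => prod_le_prod (fun k _ => by split_ifs <;> [exact hw k; exact zero_le_one])
      fun k _ => by split_ifs <;> [exact h k; exact le_rfl]

/-- The Jacobian is continuous. -/
theorem continuous_jac : Continuous (jac : (Fin D → ℝ) → ℝ) := by
  unfold jac
  exact continuous_finsetProd _ fun l _ => continuous_finsetProd _ fun k _ => by
    split_ifs <;> [exact continuous_apply k; exact continuous_const]

/-! ### The derivative of the chart -/

/-- The derivative of the chart at `w`. -/
def nderiv (f : Fin D → Fin D → ℝ) (w : Fin D → ℝ) : (Fin D → ℝ) →L[ℝ] (Fin D → ℝ) :=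
  LinearMap.toContinuousLinearMap (Matrix.toLin' (fmat f * cjac w))

/-- The determinant of the derivative. -/
theorem det_nderiv (f : Fin D → Fin D → ℝ) (w : Fin D → ℝ) :
    (nderiv f w).det = (fmat f).det * jac w := by
  unfold nderiv
  rw [ContinuousLinearMap.det, LinearMap.coe_toContinuousLinearMap, LinearMap.det_toLin',
    Matrix.det_mul, det_cjac]

/-- The derivative in coordinates. -/
theorem nderiv_apply (f : Fin D → Fin D → ℝ) (w h : Fin D → ℝ) (i : Fin D) :
    nderiv f w h i = ∑ l, f l i * ∑ j, cjac w l j * h j := by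
  simp only [nderiv, LinearMap.coe_toContinuousLinearMap', Matrix.toLin'_apply, Matrix.mulVec,
    dotProduct, Matrix.mul_apply, fmat, Matrix.of_apply]
  simp_rw [Finset.sum_mul]
  rw [Finset.sum_comm]
  refine Finset.sum_congr rfl fun l _ => ?_
  rw [Finset.mul_sum]
  refine Finset.sum_congr rfl fun j _ => ?_
  ring

/-- The nested products are differentiable, with the rows of `cjac` as gradients. -/
theorem hasFDerivAt_cum (w : Fin D → ℝ) (l : Fin D) :
    HasFDerivAt (fun w : Fin D → ℝ => cum w l)
      (∑ j, (∏ k ∈ univ.erase j, (if k ≤ l then w k else 1)) •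
        (if j ≤ l then ContinuousLinearMap.proj (R := ℝ) (φ := fun _ : Fin D => ℝ) j else 0)) w := by
  have hg : ∀ j ∈ (univ : Finset (Fin D)),
      HasFDerivAt (fun w : Fin D → ℝ => if j ≤ l then w j else 1)
        (if j ≤ l then ContinuousLinearMap.proj (R := ℝ) (φ := fun _ : Fin D => ℝ) j else 0) w := by
    intro j _
    by_cases h : j ≤ l
    · simp only [h, if_true]; exact hasFDerivAt_apply j w
    · simp only [h, if_false]; exact hasFDerivAt_const _ _
  exact HasFDerivAt.finsetProd hg

/-- **The chart is differentiable** with derivative `nderiv`. -/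
theorem hasFDerivAt_npt (z₁ : Fin D → ℝ) (f : Fin D → Fin D → ℝ) (w : Fin D → ℝ) :
    HasFDerivAt (fun w => z₁ + npt f w) (nderiv f w) w := by
  refine hasFDerivAt_pi'' fun i => ?_
  have hc : ∀ l ∈ (univ : Finset (Fin D)), HasFDerivAt (fun w : Fin D → ℝ => cum w l * f l i)
      (f l i • ∑ j, (∏ k ∈ univ.erase j, (if k ≤ l then w k else 1)) •
        (if j ≤ l then ContinuousLinearMap.proj (R := ℝ) (φ := fun _ : Fin D => ℝ) j else 0)) w :=
    fun l _ => (hasFDerivAt_cum w l).mul_const (f l i)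
  have hs := (HasFDerivAt.sum hc).const_add (z₁ i)
  have e : (fun x : Fin D → ℝ => z₁ i + (∑ l ∈ univ, fun w : Fin D → ℝ => cum w l * f l i) x) =
      fun w => (z₁ + npt f w) i := by
    funext w; simp [Finset.sum_apply, npt_apply]
  rw [e] at hs
  refine hs.congr_fderiv (ContinuousLinearMap.ext fun h => ?_)
  show _ = nderiv f w h i
  rw [nderiv_apply]
  simp only [FunLike.coe_sum, Finset.sum_apply, FunLike.coe_smul,
    Pi.smul_apply, smul_eq_mul]
  refine Finset.sum_congr rfl fun l _ => ?_
  congr 1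
  refine Finset.sum_congr rfl fun j _ => ?_
  simp only [cjac, Matrix.of_apply]
  split_ifs with hjl
  · simp [mul_comm]
  · simp

/-! ### Injectivity -/

/-- Positive points with the same nested products are equal. -/
theorem eq_of_cum_eq {w w' : Fin D → ℝ} (hw' : ∀ j, 0 < w' j) (h : ∀ l, cum w l = cum w' l) :
    w = w' := by
  have key : ∀ n : ℕ, ∀ l : Fin D, (l : ℕ) = n → w l = w' l := by
    intro n
    induction n using Nat.strong_induction_on with
    | _ n ih =>
      intro l hl
      have e : ∀ j : Fin D, j < l → w j = w' j := fun j hj => ih j (hl ▸ hj) j rfl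
      have hc := h l
      unfold cum at hc
      rw [← mul_prod_erase univ _ (mem_univ l),
        ← mul_prod_erase univ (fun j => if j ≤ l then w' j else 1) (mem_univ l)] at hc
      have hP : (∏ j ∈ univ.erase l, if j ≤ l then w j else (1 : ℝ)) =
          ∏ j ∈ univ.erase l, if j ≤ l then w' j else (1 : ℝ) := by
        refine prod_congr rfl fun j hj => ?_
        by_cases hjl : j ≤ l
        · have hlt : j < l := lt_of_le_of_ne hjl (ne_of_mem_erase hj)
          rw [if_pos hjl, if_pos hjl, e j hlt]
        · rw [if_neg hjl, if_neg hjl]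
      have hPpos : 0 < ∏ j ∈ univ.erase l, if j ≤ l then w' j else (1 : ℝ) :=
        prod_pos fun j _ => by split_ifs <;> [exact hw' j; exact one_pos]
      rw [hP, if_pos le_rfl, if_pos le_rfl] at hc
      exact mul_right_cancel₀ hPpos.ne' hc
  funext l
  exact key l l rfl

/-- **The chart is injective on the open box** for a genuine frame. -/
theorem npt_injOn (z₁ : Fin D → ℝ) (f : Fin D → Fin D → ℝ) (hdet : (fmat f).det ≠ 0)
    (δ : Fin D → ℝ) : InjOn (fun w => z₁ + npt f w) (box δ) := by
  intro w _ w' hw' h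
  have h1 : npt f w = npt f w' := add_left_cancel h
  rw [npt_eq_mulVec, npt_eq_mulVec] at h1
  have hinj : Function.Injective (fmat f).mulVec :=
    Matrix.mulVec_injective_iff_isUnit.2 ((Matrix.isUnit_iff_isUnit_det _).2 (isUnit_iff_ne_zero.2 hdet))
  have h2 := hinj h1
  exact eq_of_cum_eq (fun j => (mem_box.1 hw' j).1) (fun l => congrFun h2 l)

/-! ### The sector integral in blown-up coordinates -/

/-- **The nested-sector integral in blown-up coordinates.** See the module docstring. -/
theorem lintegral_nsec (z₁ : Fin D → ℝ) (f : Fin D → Fin D → ℝ) (hdet : (fmat f).det ≠ 0)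
    (δ : Fin D → ℝ) (G : (Fin D → ℝ) → ℝ≥0∞) :
    ∫⁻ x in nsec z₁ f δ, G x =
      ENNReal.ofReal |(fmat f).det| * ∫⁻ w in box δ, ENNReal.ofReal (jac w) * G (z₁ + npt f w) := by
  have hd : ∀ w ∈ box δ, HasFDerivWithinAt (fun w => z₁ + npt f w) (nderiv f w) (box δ) w :=
    fun w _ => (hasFDerivAt_npt z₁ f w).hasFDerivWithinAt
  rw [nsec, lintegral_image_eq_lintegral_abs_det_fderiv_mul volume (measurableSet_box δ) hd
    (npt_injOn z₁ f hdet δ) G, ← lintegral_const_mul' _ _ ENNReal.ofReal_ne_top]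
  refine setLIntegral_congr_fun (measurableSet_box δ) fun w hw => ?_
  rw [det_nderiv, abs_mul, ENNReal.ofReal_mul (abs_nonneg _),
    abs_of_pos (jac_pos fun j => (mem_box.1 hw j).1), mul_assoc]

/-- Nested sectors are monotone in the scale. -/
theorem nsec_mono (z₁ : Fin D → ℝ) (f : Fin D → Fin D → ℝ) {δ δ' : Fin D → ℝ} (h : ∀ l, δ l ≤ δ' l) :
    nsec z₁ f δ ⊆ nsec z₁ f δ' :=
  Set.image_mono (box_mono h)

/-- Points of a nested sector. -/
theorem mem_nsec {z₁ : Fin D → ℝ} {f : Fin D → Fin D → ℝ} {δ : Fin D → ℝ} {w : Fin D → ℝ}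
    (hw : w ∈ box δ) : z₁ + npt f w ∈ nsec z₁ f δ :=
  mem_image_of_mem _ hw

end SepAll

/-- **The nested-sector integral in blown-up coordinates, any depth** (registered part of
`stub_separateHigh_hH`; literal form of `SepAll.lintegral_nsec`): for a frame `f` of `ℝ^D` with
invertible frame matrix, the integral of `G ≥ 0` over the nested thin sector
`{z₁ + ∑_l (∏_{j ≤ l} w j) • f l | w ∈ ∏ (0, δ l)}` equals `|det| ∫_{∏ (0, δ l)} jac w · G (chart w)`
with the Jacobian `jac w = ∏_l ∏_{k ≠ l, k ≤ l} w k`. -/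
theorem separateAllHH_chart (D : ℕ) (z₁ : Fin D → ℝ) (f : Fin D → Fin D → ℝ) (hdet : (Matrix.of fun i l => f l i).det ≠ 0) (δ : Fin D → ℝ) (G : (Fin D → ℝ) → ENNReal) : MeasureTheory.lintegral (MeasureTheory.volume.restrict ((fun w : Fin D → ℝ => z₁ + ∑ l, (∏ j, if j ≤ l then w j else 1) • f l) '' Set.univ.pi fun l => Set.Ioo 0 (δ l))) G = ENNReal.ofReal |(Matrix.of fun i l => f l i).det| * MeasureTheory.lintegral (MeasureTheory.volume.restrict (Set.univ.pi fun l => Set.Ioo 0 (δ l))) (fun w => ENNReal.ofReal (∏ l, ∏ k ∈ Finset.univ.erase l, (if k ≤ l then w k else 1)) * G (z₁ + ∑ l, (∏ j, if j ≤ l then w j else 1) • f l)) := by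
  exact SepAll.lintegral_nsec z₁ f hdet δ G

end Summit.KontsevichZagierPeriods.ArrangementNormalForm.JanusBands
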